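/-
Copyright: rh-split cell (screw, bridge) gen 18, 2026-08-28.  Splitting search over kernel-typed
RH-equivalences.  A splitting `A ∧ B ⟹ RH` is CONDITIONAL bookkeeping unless `A` and `B` are both
proved; nothing here bears on the truth of RH.
-/
import Summits.RiemannHypothesis.RiemannHypothesis.Theorems.Splittings.ScrewShieldingSeam
import Literature.NumberTheory.LFunctions.PsiDifferencedExplicitFormula
import Literature.NumberTheory.LFunctions.ZetaZeroInvSqLimitNumerics
import HarnessLib

/-!
# The `log T / (π T)` ceiling on the shielded Blaschke products (row X-SH, quantitative form)

`ScrewShieldingSeam.latticeCeiling_dichotomy_shieldDecay` says: under the lattice ceiling `CEIL(h)`,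
either RH holds, or at every top-layer pole `a = w_{ρ₁}` the finite Blaschke products over the other
top-layer poles decay like a power of the charge tail,
`c₀ · (Π_{ρ∈F} |bl(w_ρ, a)|)^{1+κ} < Σ_{ρ∉F, w_ρ≠a} ‖c_ρ w_ρ/2‖`.
Here we bound the right-hand side by the tree's UNCONDITIONAL second-moment tail of the zeros
(`Literature…sum_inv_sq_tail_le_unconditional`, Brent–Platt–Trudgian 2022 Lemma 5 made fact-free for
`T > 168π`): for every admissible finite `F` containing all top-layer zeros of height `≤ T`,
`Σ_{ρ∉F} ‖c_ρ w_ρ/2‖ ≤ Σ_{|Im ρ|>T} m(ρ)/|Im ρ|² ≤ log T/(π T)`.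

§§1–3 are parametric in a one-sided tail bound `B` / stated against the tree's tail functional
`PsiDifferenced.tailPow 2 T = Σ_{|Im ρ|>T} m(ρ)/|Im ρ|²` and have the STANDARD axiom closure; §4 plugs in
the tree's numerical bound, whose closure carries the tree's `native_decide` certificate axiom
`TrudgianNumerics.trudgianCheck_eq_true._native…` (file the module `--computational`, or drop §4).

* `tailPow_two_le_of_oneSided` — symmetrisation: a one-sided bound `Σ_{T<γ≤U} m(ρ)/γ² ≤ B` uniform in
  `U` gives `tailPow 2 T ≤ 2B` (`SchoenfeldBound.sum_sdiff_zerosUpTo_eq_two_mul`; the pattern of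
  `PsiFromZeros2516.tailPow_five_le`).
* `charge_tail_le_tailPow` — the charge tail of the top layer beyond an admissible `F ⊇ {|Im ρ| ≤ T}`
  is `≤ tailPow 2 T`; `exists_admissible` — admissible `F` exist.
* `latticeCeiling_dichotomy_tailPow` — **`CEIL(h) ⟹ RH ∨` (at every top pole `a`, for some `c₀ > 0`,
  all `T ≥ 1` and every admissible finite `F` containing the top-layer zeros of height `≤ T`:
  `c₀ · (Π_{ρ∈F} |bl(w_ρ,a)|)^{1+κ} < tailPow 2 T`)** (standard axioms).
* §4 `tailPow_two_le` — `tailPow 2 T ≤ log T/(π T)` for `T > 168π` (from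
  `sum_inv_sq_tail_le_unconditional`, Brent–Platt–Trudgian 2022 Lemma 5); `latticeCeiling_dichotomy_logT`
  — the same dichotomy with right-hand side `log T/(π T)`, i.e. the truncated Carleson sums
  `Σ_{ρ∈F} -log|bl(w_ρ,a)| > (log(πT/log T) + log c₀)/(1+κ) = ((δ₁-d₁)/δ₁ - o(1))·log T`
  (`κ = d₁/(δ₁-d₁)`, `ScrewBlaschkeShielding.shieldExp`).

No prime-side input; every ingredient on the zero side is unconditional (zero counting).  This is an
(s)-instrument: it quantifies the blind spot of the one-lattice engine, it does not shrink it.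
-/

noncomputable section

set_option linter.dupNamespace false

namespace Summit.RiemannHypothesis.RiemannHypothesis.Theorems.Splittings.ScrewShieldingLogT

open Complex Filter Topology Set Metric
open scoped ComplexConjugate
open Literature.NumberTheory.LFunctions
open Literature.NumberTheory.LFunctions.NicolasJExplicit
open Literature.NumberTheory.LFunctions.SchoenfeldBound
open Literature.NumberTheory.LFunctions.PsiDifferenced
open ZetaZeros.riemannZetaNontrivialZeros
open Summit.RiemannHypothesis.RiemannHypothesis.Theorems.Splittings
open Summit.RiemannHypothesis.RiemannHypothesis.Theorems.Splittings.ScrewLatticeContinuation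
open Summit.RiemannHypothesis.RiemannHypothesis.Theorems.Splittings.ScrewBlaschkeTop
open Summit.RiemannHypothesis.RiemannHypothesis.Theorems.Splittings.ScrewBlaschkeRigidity
open Summit.RiemannHypothesis.RiemannHypothesis.Theorems.Splittings.ScrewBlaschkeSeam
open Summit.RiemannHypothesis.RiemannHypothesis.Theorems.Splittings.ScrewBlaschkeShielding
open Summit.RiemannHypothesis.RiemannHypothesis.Theorems.Splittings.ScrewShieldingSeam

/-! ## 1. The two-sided second-moment tail of the zeros from a one-sided bound -/

/-- **Symmetrisation.**  A one-sided bound `Σ_{T<γ≤U} m(ρ)/γ² ≤ B` uniform in `U` (`T ≥ 1`) gives the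
two-sided tail `tailPow 2 T = Σ_{|Im ρ| > T} m(ρ)/|Im ρ|² ≤ 2B` (`sum_sdiff_zerosUpTo_eq_two_mul`). -/
theorem tailPow_two_le_of_oneSided {T B : ℝ} (hT1 : 1 ≤ T)
    (hB : ∀ U : ℝ, ∑ ρ ∈ zerosBetween T U, (riemannZetaZeroOrder ρ : ℝ) * (1 / ρ.im ^ 2) ≤ B) :
    tailPow 2 T ≤ 2 * B := by
  classical
  have hT0 : (0 : ℝ) ≤ T := by linarith
  refine hasSum_le_of_sum_le (hasSum_tailPow (le_refl 2) hT1) fun s ↦ ?_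
  set U : ℝ := T + ∑ ρ ∈ s, |((ρ : ℂ)).im| with hUdef
  have hTU : T ≤ U := by
    rw [hUdef]; linarith [Finset.sum_nonneg (fun ρ (_ : ρ ∈ s) ↦ abs_nonneg (((ρ : Zeros) : ℂ).im))]
  have hle : ∀ ρ ∈ s, |((ρ : ℂ)).im| ≤ U := fun ρ hρ ↦ by
    rw [hUdef]
    have := Finset.single_le_sum (fun ρ' (_ : ρ' ∈ s) ↦ abs_nonneg (((ρ' : Zeros) : ℂ).im)) hρ
    linarith
  have h1 : ∑ ρ ∈ s, (if ρ ∈ zerosUpTo T then 0 else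
      (riemannZetaZeroOrder (ρ : ℂ) : ℝ) / |((ρ : ℂ)).im| ^ 2) ≤
      ∑ ρ ∈ zerosUpTo U \ zerosUpTo T, (riemannZetaZeroOrder (ρ : ℂ) : ℝ) / |((ρ : ℂ)).im| ^ 2 := by
    rw [← Finset.sum_filter_add_sum_filter_not s (fun ρ ↦ ρ ∈ zerosUpTo T)]
    rw [Finset.sum_congr rfl (fun ρ hρ ↦ if_pos (Finset.mem_filter.1 hρ).2), Finset.sum_const_zero,
      zero_add, Finset.sum_congr rfl (fun ρ hρ ↦ if_neg (Finset.mem_filter.1 hρ).2)]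
    refine Finset.sum_le_sum_of_subset_of_nonneg (fun ρ hρ ↦ ?_) fun ρ _ _ ↦
      div_nonneg (zeroOrder_nonneg' ρ) (by positivity)
    rw [Finset.mem_filter] at hρ
    exact Finset.mem_sdiff.2 ⟨mem_zerosUpTo.2 (hle ρ hρ.1), hρ.2⟩
  have h2 := sum_sdiff_zerosUpTo_eq_two_mul hT0 (T₂ := U)
    (g := fun z ↦ (riemannZetaZeroOrder z : ℝ) / |z.im| ^ 2)
    (fun z ↦ by simp only [riemannZetaZeroOrder_conj_holds z, Complex.conj_im, abs_neg])
  have h3 : ∑ ρ ∈ zerosBetween T U, (riemannZetaZeroOrder ρ : ℝ) / |ρ.im| ^ 2 =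
      ∑ ρ ∈ zerosBetween T U, (riemannZetaZeroOrder ρ : ℝ) * (1 / ρ.im ^ 2) := by
    refine Finset.sum_congr rfl fun ρ hρ ↦ ?_
    obtain ⟨-, -, -, h3, -⟩ := (mem_zerosBetween hT0).1 hρ
    rw [abs_of_pos (by linarith), div_eq_mul_one_div]
  have h4 := hB U
  calc ∑ ρ ∈ s, (if ρ ∈ zerosUpTo T then 0 else
        (riemannZetaZeroOrder (ρ : ℂ) : ℝ) / |((ρ : ℂ)).im| ^ 2)
      ≤ ∑ ρ ∈ zerosUpTo U \ zerosUpTo T, (riemannZetaZeroOrder (ρ : ℂ) : ℝ) / |((ρ : ℂ)).im| ^ 2 := h1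
    _ = 2 * ∑ ρ ∈ zerosBetween T U, (riemannZetaZeroOrder ρ : ℝ) * (1 / ρ.im ^ 2) := by rw [h2, h3]
    _ ≤ 2 * B := by linarith

/-! ## 2. The charge tail of the top layer beyond height `T` -/

/-- One charge: `‖c_ρ w_ρ / 2‖ ≤ m(ρ)/|Im ρ|²` (`‖c_ρ‖ ≤ 2 m(ρ)/Im(ρ)²`, `ScrewLatticeSup.norm_coeff_le`;
`‖w_ρ‖ < 1`). -/
theorem norm_charge_le {h : ℝ} (hh : 0 < h)
    (hlt : ∀ ρ : ℂ, ρ ∈ ZetaZeros.riemannZetaNontrivialZeros → ρ.re < supRe)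
    (ρ : ZetaZeros.riemannZetaNontrivialZeros) :
    ‖coeff ρ * wp h ρ / 2‖ ≤ (riemannZetaZeroOrder (ρ : ℂ) : ℝ) / |(ρ : ℂ).im| ^ 2 := by
  have hc : ‖coeff ρ‖ ≤ 2 * (riemannZetaZeroOrder (ρ : ℂ) : ℝ) / (ρ : ℂ).im ^ 2 :=
    ScrewLatticeSup.norm_coeff_le ρ
  have hw : ‖wp h ρ‖ ≤ 1 := (norm_wp_lt_one hh hlt ρ).le
  rw [norm_div, norm_mul, sq_abs]
  have h2 : ‖(2 : ℂ)‖ = 2 := by simp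
  rw [h2]
  have : ‖coeff ρ‖ * ‖wp h ρ‖ ≤ ‖coeff ρ‖ := mul_le_of_le_one_right (norm_nonneg _) hw
  have hγ2 : 0 < (ρ : ℂ).im ^ 2 := by
    have := im_ne_zero ρ.2
    positivity
  rw [div_le_iff₀ (by norm_num : (0 : ℝ) < 2)]
  calc ‖coeff ρ‖ * ‖wp h ρ‖ ≤ ‖coeff ρ‖ := this
    _ ≤ 2 * (riemannZetaZeroOrder (ρ : ℂ) : ℝ) / (ρ : ℂ).im ^ 2 := hc
    _ = (riemannZetaZeroOrder (ρ : ℂ) : ℝ) / (ρ : ℂ).im ^ 2 * 2 := by ring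

/-- **Charge tail `≤ tailPow 2 T`.**  If a finite set `F` of top-layer zeros contains every top-layer
zero `ρ` of height `|Im ρ| ≤ T` with `w_ρ ≠ a` (`T ≥ 1`), then the charge tail outside `F` and off the
pole `a` is at most the two-sided second-moment tail of ALL zeros beyond height `T`. -/
theorem charge_tail_le_tailPow {h δ : ℝ} (hh : 0 < h)
    (hlt : ∀ ρ : ℂ, ρ ∈ ZetaZeros.riemannZetaNontrivialZeros → ρ.re < supRe)
    (a : ℂ) {T : ℝ} (hT1 : 1 ≤ T) (F : Finset (topSet δ))
    (hFT : ∀ ρ : topSet δ, |((ρ : ZetaZeros.riemannZetaNontrivialZeros) : ℂ).im| ≤ T →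
      wp h ρ ≠ a → ρ ∈ F) :
    ∑' ρ : {ρ : topSet δ // ρ ∉ F ∧ wp h ρ ≠ a},
        ‖coeff ((ρ : topSet δ) : ZetaZeros.riemannZetaNontrivialZeros) * wp h (ρ : topSet δ) / 2‖ ≤
      tailPow 2 T := by
  classical
  -- compare term by term along the injection into all zeros
  set e : {ρ : topSet δ // ρ ∉ F ∧ wp h ρ ≠ a} → Zeros :=
    fun x ↦ ⟨(((x : topSet δ) : ZetaZeros.riemannZetaNontrivialZeros) : ℂ), (x : topSet δ).1.2⟩ with he
  have hinj : Function.Injective e := by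
    intro x y hxy
    have h1 : (((x : topSet δ) : ZetaZeros.riemannZetaNontrivialZeros) : ℂ) =
        (((y : topSet δ) : ZetaZeros.riemannZetaNontrivialZeros) : ℂ) := by
      simpa [he] using congrArg Subtype.val hxy
    exact Subtype.ext (Subtype.ext (Subtype.ext h1))
  have hsum := summable_norm_charge (δ := δ) hh hlt
  refine Summable.tsum_le_tsum_of_inj e hinj (fun c _ ↦ tailPow_term_nonneg 2 T c) (fun x ↦ ?_)
    (hsum.subtype _) (summable_tailPow (le_refl 2) hT1)
  -- the term at `x`: `x ∉ F`, `w_x ≠ a`, hence `|Im x| > T` and the indicator is off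
  have hx : ¬ (e x ∈ zerosUpTo T) := by
    intro hmem
    have habs : |(((x : topSet δ) : ZetaZeros.riemannZetaNontrivialZeros) : ℂ).im| ≤ T := by
      simpa [he] using mem_zerosUpTo.1 hmem
    exact x.2.1 (hFT _ habs x.2.2)
  show ‖coeff ((x : topSet δ) : ZetaZeros.riemannZetaNontrivialZeros) * wp h (x : topSet δ) / 2‖ ≤
    (if e x ∈ zerosUpTo T then 0 else (riemannZetaZeroOrder (e x : ℂ) : ℝ) / |((e x : ℂ)).im| ^ 2)
  rw [if_neg hx]
  exact norm_charge_le hh hlt _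

/-- Admissible finite sets exist: the top-layer zeros of height `≤ T` off the pole `a` form a finite
set (`SchoenfeldBound.zerosUpToSet_finite`). -/
theorem exists_admissible (h δ : ℝ) (a : ℂ) (T : ℝ) :
    ∃ F : Finset (topSet δ), (∀ ρ ∈ F, wp h ρ ≠ a) ∧
      ∀ ρ : topSet δ, |((ρ : ZetaZeros.riemannZetaNontrivialZeros) : ℂ).im| ≤ T →
        wp h ρ ≠ a → ρ ∈ F := by
  classical
  set e : topSet δ → Zeros :=
    fun x ↦ ⟨((x : ZetaZeros.riemannZetaNontrivialZeros) : ℂ), x.1.2⟩ with he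
  have hinj : Function.Injective e := by
    intro x y hxy
    have h1 : ((x : ZetaZeros.riemannZetaNontrivialZeros) : ℂ) =
        ((y : ZetaZeros.riemannZetaNontrivialZeros) : ℂ) := by
      simpa [he] using congrArg Subtype.val hxy
    exact Subtype.ext (Subtype.ext h1)
  have hfin : ({ρ : topSet δ | |((ρ : ZetaZeros.riemannZetaNontrivialZeros) : ℂ).im| ≤ T ∧
      wp h ρ ≠ a} : Set (topSet δ)).Finite := by
    refine ((zerosUpToSet_finite T).preimage hinj.injOn).subset ?_
    intro ρ hρ
    exact hρ.1
  refine ⟨hfin.toFinset, fun ρ hρ ↦ ((Set.Finite.mem_toFinset hfin).1 hρ).2, fun ρ h1 h2 ↦ ?_⟩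
  exact (Set.Finite.mem_toFinset hfin).2 ⟨h1, h2⟩

/-! ## 3. The structure theorem against the tail functional (standard axioms) -/

/-- **`CEIL(h) ⟹ RH ∨ (power-law Blaschke decay against the zero tail at every top pole).**
Under the lattice ceiling: either RH, or for every `0 < δ ≤ Θ - 1/2`, every top zero `ρ₁ ∈ TOP(δ)` and
every leak radius `e^{-δh} < r₁ < |w_{ρ₁}|` there is `c₀ > 0` with
`c₀ · (Π_{ρ∈F} |bl(w_ρ, w_{ρ₁})|)^{1+κ} < tailPow 2 T = Σ_{|Im ρ|>T} m(ρ)/|Im ρ|²` for all `T ≥ 1` and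
every finite set `F` of top zeros off the pole containing those of height `≤ T`. -/
theorem latticeCeiling_dichotomy_tailPow {h : ℝ} (hh : 0 < h)
    (hceil : ∀ ε : ℝ, 0 < ε → ∃ K : ℝ, ∀ k : ℕ, |zetaScrew (k * h)| ≤ K * Real.exp (ε * k)) :
    RiemannHypothesis ∨
      (1 / 2 < supRe ∧ (∀ ρ : ℂ, ρ ∈ ZetaZeros.riemannZetaNontrivialZeros → ρ.re < supRe) ∧
        ∀ δ : ℝ, 0 < δ → δ ≤ supRe - 1 / 2 → ∀ ρ₁ : topSet δ, ∀ r₁ : ℝ,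
          Real.exp (-(δ * h)) < r₁ → r₁ < ‖wp h ρ₁‖ →
            ∃ c₀ : ℝ, 0 < c₀ ∧ ∀ T : ℝ, 1 ≤ T →
              ∀ F : Finset (topSet δ), (∀ ρ ∈ F, wp h ρ ≠ wp h ρ₁) →
                (∀ ρ : topSet δ, |((ρ : ZetaZeros.riemannZetaNontrivialZeros) : ℂ).im| ≤ T →
                  wp h ρ ≠ wp h ρ₁ → ρ ∈ F) →
                c₀ * (∏ ρ ∈ F, ‖bl (wp h ρ) (wp h ρ₁)‖) ^ (1 + shieldExp (wp h ρ₁) r₁) < tailPow 2 T) := by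
  rcases latticeCeiling_dichotomy_shieldDecay hh hceil with hRH | ⟨hΘ, hlt, hdec⟩
  · exact Or.inl hRH
  · refine Or.inr ⟨hΘ, hlt, fun δ hδ hδΘ ρ₁ r₁ hr₁ hr₁a ↦ ?_⟩
    obtain ⟨c₀, hc₀, hdecF⟩ := hdec δ hδ hδΘ ρ₁ r₁ hr₁ hr₁a
    refine ⟨c₀, hc₀, fun T hT F hF hFT ↦ ?_⟩
    exact lt_of_lt_of_le (hdecF F hF) (charge_tail_le_tailPow hh hlt (wp h ρ₁) hT F hFT)

/-! ## 4. The `log T/(π T)` ceiling (inherits the tree's `native_decide` numerics certificate) -/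

/-- **`Σ_{|Im ρ| > T} m(ρ)/|Im ρ|² ≤ log T/(π T)` for `T > 168π`** (two-sided; unconditional): the
one-sided tree bound `sum_inv_sq_tail_le_unconditional` (`≤ log T/(2πT)`, uniform in `U`), symmetrised. -/
theorem tailPow_two_le {T : ℝ} (hT : 168 * Real.pi < T) :
    tailPow 2 T ≤ Real.log T / (Real.pi * T) := by
  have hπ : 3 < Real.pi := Real.pi_gt_three
  have hT1 : (1 : ℝ) ≤ T := by linarith
  have h := tailPow_two_le_of_oneSided hT1 (fun U ↦ sum_inv_sq_tail_le_unconditional (U := U) hT)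
  have h5 : 2 * (Real.log T / (2 * Real.pi * T)) = Real.log T / (Real.pi * T) := by
    field_simp
  linarith

/-- **`CEIL(h) ⟹ RH ∨ (power-law Blaschke decay against `log T/(π T)` at every top pole).**
Under the lattice ceiling: either RH, or `Θ > 1/2` is not attained and for every `0 < δ ≤ Θ - 1/2`,
every top zero `ρ₁ ∈ TOP(δ)` and every leak radius `e^{-δh} < r₁ < |w_{ρ₁}|` there is `c₀ > 0` with
`c₀ · (Π_{ρ∈F} |bl(w_ρ, w_{ρ₁})|)^{1+κ} < log T/(π T)` for all `T > 168π` and every finite set `F`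
of top zeros off the pole containing those of height `≤ T` (`κ = shieldExp (w_{ρ₁}) r₁`).
Equivalently the truncated Carleson sums `Σ_{ρ∈F} -log|bl(w_ρ, w_{ρ₁})|` exceed
`(log(πT/log T) + log c₀)/(1+κ)`. -/
theorem latticeCeiling_dichotomy_logT {h : ℝ} (hh : 0 < h)
    (hceil : ∀ ε : ℝ, 0 < ε → ∃ K : ℝ, ∀ k : ℕ, |zetaScrew (k * h)| ≤ K * Real.exp (ε * k)) :
    RiemannHypothesis ∨
      (1 / 2 < supRe ∧ (∀ ρ : ℂ, ρ ∈ ZetaZeros.riemannZetaNontrivialZeros → ρ.re < supRe) ∧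
        ∀ δ : ℝ, 0 < δ → δ ≤ supRe - 1 / 2 → ∀ ρ₁ : topSet δ, ∀ r₁ : ℝ,
          Real.exp (-(δ * h)) < r₁ → r₁ < ‖wp h ρ₁‖ →
            ∃ c₀ : ℝ, 0 < c₀ ∧ ∀ T : ℝ, 168 * Real.pi < T →
              ∀ F : Finset (topSet δ), (∀ ρ ∈ F, wp h ρ ≠ wp h ρ₁) →
                (∀ ρ : topSet δ, |((ρ : ZetaZeros.riemannZetaNontrivialZeros) : ℂ).im| ≤ T →
                  wp h ρ ≠ wp h ρ₁ → ρ ∈ F) →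
                c₀ * (∏ ρ ∈ F, ‖bl (wp h ρ) (wp h ρ₁)‖) ^ (1 + shieldExp (wp h ρ₁) r₁) <
                  Real.log T / (Real.pi * T)) := by
  rcases latticeCeiling_dichotomy_tailPow hh hceil with hRH | ⟨hΘ, hlt, hdec⟩
  · exact Or.inl hRH
  · refine Or.inr ⟨hΘ, hlt, fun δ hδ hδΘ ρ₁ r₁ hr₁ hr₁a ↦ ?_⟩
    obtain ⟨c₀, hc₀, hdecF⟩ := hdec δ hδ hδΘ ρ₁ r₁ hr₁ hr₁a
    have hπ : 3 < Real.pi := Real.pi_gt_three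
    refine ⟨c₀, hc₀, fun T hT F hF hFT ↦ ?_⟩
    exact lt_of_lt_of_le (hdecF T (by linarith) F hF hFT) (tailPow_two_le hT)

end Summit.RiemannHypothesis.RiemannHypothesis.Theorems.Splittings.ScrewShieldingLogT
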